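import Literature.Analysis.FluidPDE.GaussianVortexPlanar
import Literature.Analysis.FunctionSpaces.SobolevDomain
import Mathlib.Analysis.SpecialFunctions.SmoothTransition
import Mathlib.Analysis.InnerProductSpace.Calculus
import Mathlib.MeasureTheory.Integral.IntervalIntegral.FundThmCalculus
import Mathlib.MeasureTheory.Function.LocallyIntegrable
import HarnessLib

/-!
# Crux `BlockLipschitzL` (stmt-QuantumFields-23533) ∕ `HistoryTailL` (stmt-QuantumFields-19936), LINE 25 «CompactnessTransfer»,
# stub S1″ — ROAD (W) «the H-system gap at 3π», brick W-ONE «WENTE ONE-CENTRE LEMMA», file 1: LETTERS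

Cell `ym3-torus` (YM ladder rung R3 = continuum SU(2) Yang–Mills on T³ — a RUNG, NOT Clay: not d = 4, not infinite volume,
not a mass gap); TWIN-WIDTH helper seat `ym-ust-19936-w7` g15; `--supports stmt-QuantumFields-23533`; THEOREMS ONLY (0 `def`,
0 `sorry`, default heartbeats); Mathlib + lit `GaussianVortexPlanar` (`perp ξ = (−ξ₁, ξ₀)`) + lit `SobolevDomain` (`HasWeakFDerivOn`).

WHAT THIS FILE PROVES (letters for the master identity of W-ONE; `E² = EuclideanSpace ℝ (Fin 2)`, `s = ‖y − x₀‖²`):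
* §1 radial profiles: for a smooth `g : ℝ → ℝ` vanishing on `[S, ∞)`, the RADIAL VECTOR FIELD `V y = g(s)•(y − x₀)` has smooth
  compactly supported components `V_k y = g(s)·(y − x₀)_k` with `Σ_k ∂_k V_k = 2(s·g′(s) + g(s))` EVERYWHERE (no case split at the
  centre: everything is a smooth function of `s = ‖y − x₀‖²`), and the RADIAL TEST FUNCTION `η y = Γ(s)`, `Γ(s) = ½∫_S^s g`, is
  smooth, compactly supported, with `∂_k η = V_k`.
* §2 ★ `integral_div_radial_mul_eq` — testing a weak gradient `Gu` of `u` on the whole plane with `V`: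
  `∫ 2(s g′ + g)(s)·u = −∫ g(s)·Gu y (y − x₀)`.
HONEST SCOPE.  Calculus letters; nothing of (W-OSC), (GAP), (TM), S1″, K1, `MeanDeviationL`, `BlockLipschitzL`, `HistoryTailL` is proved
here.  YM₃ on T³ is rung R3, not Clay; YM gap NOT proved; no summit statement is proved here.

References: H. Wente, J. Math. Anal. Appl. 26 (1969) 318–344; H. Brezis, J.-M. Coron, Arch. Rational Mech. Anal. 89 (1985) 21–56
[BrezisCoron1985] (Lemma A.1); F. Hélein, Harmonic Maps, Conservation Laws and Moving Frames (2002) [Helein2002] (§3.1, Wente's lemma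
by polar coordinates); P. Topping, The optimal constant in Wente's L∞ estimate, Comment. Math. Helv. 72 (1997) [Topping1997].
-/

set_option autoImplicit false

noncomputable section

open MeasureTheory Set Function Filter Topology Metric TopologicalSpace
open scoped ContDiff BigOperators RealInnerProductSpace

namespace Summit.QuantumFields.YangMills.Theorems.PoincareLipschitzWenteOneCentreLetters

open Literature.Analysis.FunctionSpaces (HasWeakFDerivOn IsTestFunctionOn)
open Literature.Analysis.FluidPDE (perp)

/-! ## §0 Two pointwise letters on `E²` -/

/-- `Σ_k v_k · L e_k = L v` for a linear functional on the plane. [folklore] -/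
theorem sum_coord_mul_apply_single (L : EuclideanSpace ℝ (Fin 2) →L[ℝ] ℝ) (v : EuclideanSpace ℝ (Fin 2)) :
    ∑ k : Fin 2, v k * L (EuclideanSpace.single k (1:ℝ)) = L v := by
  have hv : v = ∑ k : Fin 2, v k • EuclideanSpace.single k (1:ℝ) := by
    ext j; simp [Fin.sum_univ_two]
    fin_cases j <;> simp
  conv_rhs => rw [hv]
  simp [map_smul, smul_eq_mul]

/-- `L (perp w) = −w₁ · L e₀ + w₀ · L e₁`. [folklore] -/
theorem apply_perp_eq (L : EuclideanSpace ℝ (Fin 2) →L[ℝ] ℝ) (w : EuclideanSpace ℝ (Fin 2)) :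
    L (perp w) = -(w 1) * L (EuclideanSpace.single 0 (1:ℝ)) + w 0 * L (EuclideanSpace.single 1 (1:ℝ)) := by
  rw [← sum_coord_mul_apply_single L (perp w), Fin.sum_univ_two]
  simp

/-- `‖y − x₀‖² = Σ_k (y − x₀)_k²` on the plane. [folklore] -/
theorem norm_sq_eq_sum_sq (z : EuclideanSpace ℝ (Fin 2)) : ‖z‖ ^ 2 = ∑ k : Fin 2, z k ^ 2 := by
  rw [EuclideanSpace.norm_eq, Real.sq_sqrt (Finset.sum_nonneg fun _ _ => sq_nonneg _)]
  simp

/-! ## §1 Radial profiles, the radial vector field and the radial test function -/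

section Radial

variable (x₀ : EuclideanSpace ℝ (Fin 2)) {g : ℝ → ℝ}

/-- `y ↦ g(‖y − x₀‖²)` is smooth for smooth `g`. [folklore] -/
theorem contDiff_comp_norm_sq (hg : ContDiff ℝ ∞ g) :
    ContDiff ℝ ∞ (fun y : EuclideanSpace ℝ (Fin 2) => g (‖y - x₀‖ ^ 2)) :=
  hg.comp ((contDiff_norm_sq ℝ).comp (contDiff_id.sub contDiff_const))

/-- The derivative of `y ↦ g(‖y − x₀‖²)`: `g′(s) · 2⟪y − x₀, ·⟫`. [folklore] -/
theorem hasFDerivAt_comp_norm_sq (hg : ContDiff ℝ ∞ g) (y : EuclideanSpace ℝ (Fin 2)) :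
    HasFDerivAt (fun y : EuclideanSpace ℝ (Fin 2) => g (‖y - x₀‖ ^ 2))
      (deriv g (‖y - x₀‖ ^ 2) • ((2:ℝ) • innerSL ℝ (y - x₀))) y := by
  have h1 : HasFDerivAt (fun y : EuclideanSpace ℝ (Fin 2) => ‖y - x₀‖ ^ 2)
      (2 • (innerSL ℝ (id y - x₀)).comp (ContinuousLinearMap.id ℝ (EuclideanSpace ℝ (Fin 2)))) y :=
    ((hasFDerivAt_id y).sub_const x₀).norm_sq
  have h2 : HasDerivAt g (deriv g (‖y - x₀‖ ^ 2)) (‖y - x₀‖ ^ 2) :=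
    ((hg.differentiable (by simp)) _).hasDerivAt
  have h3 : HasFDerivAt (fun y : EuclideanSpace ℝ (Fin 2) => g (‖y - x₀‖ ^ 2))
      (deriv g (‖y - x₀‖ ^ 2) • (2 • (innerSL ℝ (id y - x₀)).comp (ContinuousLinearMap.id ℝ (EuclideanSpace ℝ (Fin 2))))) y :=
    h2.comp_hasFDerivAt y h1
  refine h3.congr_fderiv ?_
  refine ContinuousLinearMap.ext fun v => ?_
  simp [two_smul]

/-- `∂_k (g(‖y − x₀‖²)) = 2 g′(s) (y − x₀)_k`. [folklore] -/
theorem fderiv_comp_norm_sq_apply_single (hg : ContDiff ℝ ∞ g) (y : EuclideanSpace ℝ (Fin 2)) (k : Fin 2) :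
    fderiv ℝ (fun y : EuclideanSpace ℝ (Fin 2) => g (‖y - x₀‖ ^ 2)) y (EuclideanSpace.single k (1:ℝ)) =
      2 * deriv g (‖y - x₀‖ ^ 2) * (y - x₀) k := by
  rw [(hasFDerivAt_comp_norm_sq x₀ hg y).fderiv]
  simp [EuclideanSpace.inner_single_right]
  ring

/-- The components `V_k y = g(‖y − x₀‖²)·(y − x₀)_k` of the radial field are smooth. [folklore] -/
theorem contDiff_radialField (hg : ContDiff ℝ ∞ g) (k : Fin 2) :
    ContDiff ℝ ∞ (fun y : EuclideanSpace ℝ (Fin 2) => g (‖y - x₀‖ ^ 2) * (y - x₀) k) :=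
  (contDiff_comp_norm_sq x₀ hg).mul ((contDiff_euclidean.1 (contDiff_id.sub contDiff_const)) k)

/-- A function of `‖y − x₀‖²` through a profile vanishing on `[S, ∞)` vanishes off `closedBall x₀ √S`-ish: precisely it has
compact support. [folklore] -/
theorem hasCompactSupport_comp_norm_sq {S : ℝ} (hgS : ∀ s, S ≤ s → g s = 0) {F : EuclideanSpace ℝ (Fin 2) → ℝ} :
    HasCompactSupport (fun y : EuclideanSpace ℝ (Fin 2) => g (‖y - x₀‖ ^ 2) * F y) := by
  apply HasCompactSupport.intro (isCompact_closedBall x₀ (Real.sqrt (max S 0) + 1))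
  intro y hy
  rw [mem_closedBall, dist_eq_norm, not_le] at hy
  have hS : S ≤ ‖y - x₀‖ ^ 2 := by
    have h1 : Real.sqrt (max S 0) < ‖y - x₀‖ := by linarith
    have h2 : max S 0 < ‖y - x₀‖ ^ 2 := by
      calc max S 0 = Real.sqrt (max S 0) ^ 2 := (Real.sq_sqrt (le_max_right _ _)).symm
        _ < ‖y - x₀‖ ^ 2 := by
          exact pow_lt_pow_left₀ h1 (Real.sqrt_nonneg _) two_ne_zero
    exact (le_max_left _ _).trans h2.le
  simp [hgS _ hS]

/-- The radial field component `V_k` is a test function on the whole plane. [folklore] -/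
theorem isTestFunctionOn_radialField (hg : ContDiff ℝ ∞ g) {S : ℝ} (hgS : ∀ s, S ≤ s → g s = 0) (k : Fin 2) :
    IsTestFunctionOn (⟨univ, isOpen_univ⟩ : Opens (EuclideanSpace ℝ (Fin 2)))
      (fun y : EuclideanSpace ℝ (Fin 2) => g (‖y - x₀‖ ^ 2) * (y - x₀) k) :=
  ⟨contDiff_radialField x₀ hg k, hasCompactSupport_comp_norm_sq x₀ hgS, fun _ _ => trivial⟩

/-- **Divergence of the radial field**: `Σ_k ∂_k(g(s)(y − x₀)_k) = 2(s g′(s) + g(s))`, `s = ‖y − x₀‖²`, at EVERY point. [folklore] -/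
theorem sum_fderiv_radialField (hg : ContDiff ℝ ∞ g) (y : EuclideanSpace ℝ (Fin 2)) :
    ∑ k : Fin 2, fderiv ℝ (fun y : EuclideanSpace ℝ (Fin 2) => g (‖y - x₀‖ ^ 2) * (y - x₀) k) y (EuclideanSpace.single k (1:ℝ)) =
      2 * (‖y - x₀‖ ^ 2 * deriv g (‖y - x₀‖ ^ 2) + g (‖y - x₀‖ ^ 2)) := by
  have hc : ∀ k : Fin 2, HasFDerivAt (fun y : EuclideanSpace ℝ (Fin 2) => (y - x₀) k)
      ((EuclideanSpace.proj k : EuclideanSpace ℝ (Fin 2) →L[ℝ] ℝ).comp (ContinuousLinearMap.id ℝ (EuclideanSpace ℝ (Fin 2)))) y := by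
    intro k
    have : HasFDerivAt (fun y : EuclideanSpace ℝ (Fin 2) => y - x₀) (ContinuousLinearMap.id ℝ _) y :=
      (hasFDerivAt_id y).sub_const x₀
    exact (EuclideanSpace.proj k : EuclideanSpace ℝ (Fin 2) →L[ℝ] ℝ).hasFDerivAt.comp y this
  have hprod : ∀ k : Fin 2, fderiv ℝ (fun y : EuclideanSpace ℝ (Fin 2) => g (‖y - x₀‖ ^ 2) * (y - x₀) k) y
      (EuclideanSpace.single k (1:ℝ)) = 2 * deriv g (‖y - x₀‖ ^ 2) * (y - x₀) k * (y - x₀) k + g (‖y - x₀‖ ^ 2) := by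
    intro k
    have h : HasFDerivAt (fun y : EuclideanSpace ℝ (Fin 2) => g (‖y - x₀‖ ^ 2) * (y - x₀) k)
        (g (‖y - x₀‖ ^ 2) • (EuclideanSpace.proj k : EuclideanSpace ℝ (Fin 2) →L[ℝ] ℝ).comp
            (ContinuousLinearMap.id ℝ (EuclideanSpace ℝ (Fin 2))) +
          (y - x₀) k • (deriv g (‖y - x₀‖ ^ 2) • ((2:ℝ) • innerSL ℝ (y - x₀)))) y :=
      (hasFDerivAt_comp_norm_sq x₀ hg y).mul (hc k)
    rw [h.fderiv]
    simp [EuclideanSpace.inner_single_right]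
    ring
  simp_rw [hprod]
  rw [Finset.sum_add_distrib, Finset.sum_const, Finset.card_univ, Fintype.card_fin, norm_sq_eq_sum_sq]
  simp only [nsmul_eq_mul, Nat.cast_ofNat, Fin.sum_univ_two]
  ring

/-- The primitive `Γ(s) = ½ ∫_S^s g` of a smooth profile vanishing on `[S, ∞)` is smooth, vanishes on `[S, ∞)`, and `Γ′ = g∕2`. [folklore] -/
theorem primitive_props (hg : ContDiff ℝ ∞ g) {S : ℝ} (hgS : ∀ s, S ≤ s → g s = 0) :
    ContDiff ℝ ∞ (fun s => (1/2 : ℝ) * ∫ t in S..s, g t) ∧ (∀ s, S ≤ s → (1/2 : ℝ) * ∫ t in S..s, g t = 0) ∧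
      ∀ s, HasDerivAt (fun s => (1/2 : ℝ) * ∫ t in S..s, g t) (g s / 2) s := by
  have hgc : Continuous g := hg.continuous
  have hD : ∀ s, HasDerivAt (fun s => ∫ t in S..s, g t) (g s) s :=
    fun s => intervalIntegral.integral_hasDerivAt_right (hgc.intervalIntegrable _ _)
      hgc.aestronglyMeasurable.stronglyMeasurableAtFilter hgc.continuousAt
  have hD2 : ∀ s, HasDerivAt (fun s => (1/2 : ℝ) * ∫ t in S..s, g t) (g s / 2) s := by
    intro s
    have := (hD s).const_mul (1/2 : ℝ)
    rwa [show (1/2 : ℝ) * g s = g s / 2 by ring] at this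
  refine ⟨?_, ?_, hD2⟩
  · rw [contDiff_infty_iff_deriv]
    refine ⟨fun s => (hD2 s).differentiableAt, ?_⟩
    have : deriv (fun s => (1/2 : ℝ) * ∫ t in S..s, g t) = fun s => g s / 2 := funext fun s => (hD2 s).deriv
    rw [this]
    exact hg.div_const _
  · intro s hs
    have : ∫ t in S..s, g t = 0 := by
      rw [intervalIntegral.integral_of_le hs]
      refine setIntegral_eq_zero_of_forall_eq_zero fun t ht => hgS t ht.1.le
    rw [this, mul_zero]

/-- The radial test function `η y = Γ(‖y − x₀‖²)` has `∂_k η = g(s)(y − x₀)_k = V_k`. [folklore] -/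
theorem fderiv_radialTest_apply_single (hg : ContDiff ℝ ∞ g) {S : ℝ} (hgS : ∀ s, S ≤ s → g s = 0)
    (y : EuclideanSpace ℝ (Fin 2)) (k : Fin 2) :
    fderiv ℝ (fun y : EuclideanSpace ℝ (Fin 2) => (1/2 : ℝ) * ∫ t in S..(‖y - x₀‖ ^ 2), g t) y (EuclideanSpace.single k (1:ℝ)) =
      g (‖y - x₀‖ ^ 2) * (y - x₀) k := by
  obtain ⟨hΓ, -, hΓ'⟩ := primitive_props hg hgS
  have h := fderiv_comp_norm_sq_apply_single x₀ (g := fun s => (1/2 : ℝ) * ∫ t in S..s, g t) hΓ y k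
  simp only at h
  rw [h, (hΓ' _).deriv]
  ring

/-- The radial test function is a test function on the whole plane. [folklore] -/
theorem isTestFunctionOn_radialTest (hg : ContDiff ℝ ∞ g) {S : ℝ} (hgS : ∀ s, S ≤ s → g s = 0) :
    IsTestFunctionOn (⟨univ, isOpen_univ⟩ : Opens (EuclideanSpace ℝ (Fin 2)))
      (fun y : EuclideanSpace ℝ (Fin 2) => (1/2 : ℝ) * ∫ t in S..(‖y - x₀‖ ^ 2), g t) := by
  obtain ⟨hΓ, hΓS, -⟩ := primitive_props hg hgS
  refine ⟨contDiff_comp_norm_sq x₀ (g := fun s => (1/2 : ℝ) * ∫ t in S..s, g t) hΓ, ?_, fun _ _ => trivial⟩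
  have := hasCompactSupport_comp_norm_sq x₀ (g := fun s => (1/2 : ℝ) * ∫ t in S..s, g t) hΓS (F := fun _ => 1)
  simpa using this

end Radial

/-! ## §2 Testing a weak gradient with the radial field -/

/-- ★ **The radial field against a weak gradient.**  If `u` has weak gradient `Gu` on the whole plane and `g` is smooth with
`g = 0` on `[S, ∞)`, then `∫ 2(s g′(s) + g(s))·u(y) dy = −∫ g(s)·Gu y (y − x₀) dy`, `s = ‖y − x₀‖²` — integration by parts
against the test fields `V_k = g(s)(y − x₀)_k` summed over `k` (`Σ_k V_k·Gu e_k = g(s)·Gu (y − x₀)`). [folklore] -/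
theorem integral_div_radial_mul_eq (x₀ : EuclideanSpace ℝ (Fin 2)) {u : EuclideanSpace ℝ (Fin 2) → ℝ}
    {Gu : EuclideanSpace ℝ (Fin 2) → EuclideanSpace ℝ (Fin 2) →L[ℝ] ℝ}
    (hu : HasWeakFDerivOn (⟨univ, isOpen_univ⟩ : Opens (EuclideanSpace ℝ (Fin 2))) volume u Gu)
    {g : ℝ → ℝ} (hg : ContDiff ℝ ∞ g) {S : ℝ} (hgS : ∀ s, S ≤ s → g s = 0) :
    ∫ y, 2 * (‖y - x₀‖ ^ 2 * deriv g (‖y - x₀‖ ^ 2) + g (‖y - x₀‖ ^ 2)) * u y =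
      -∫ y, g (‖y - x₀‖ ^ 2) * Gu y (y - x₀) := by
  -- integration by parts, one coordinate at a time
  have hk : ∀ k : Fin 2,
      ∫ y, fderiv ℝ (fun y : EuclideanSpace ℝ (Fin 2) => g (‖y - x₀‖ ^ 2) * (y - x₀) k) y (EuclideanSpace.single k (1:ℝ)) * u y =
        -∫ y, g (‖y - x₀‖ ^ 2) * (y - x₀) k * Gu y (EuclideanSpace.single k (1:ℝ)) := by
    intro k
    have h := hu.integral_fderiv_smul_eq _ (EuclideanSpace.single k (1:ℝ)) (isTestFunctionOn_radialField x₀ hg hgS k)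
    simp only [Opens.coe_mk, Measure.restrict_univ, smul_eq_mul] at h
    exact h
  -- integrability of the pieces
  have hul : LocallyIntegrable u volume := by
    have := hu.locallyIntegrableOn
    simpa [locallyIntegrableOn_univ] using this
  have hGl : LocallyIntegrable Gu volume := by
    have := hu.locallyIntegrableOn_deriv
    simpa [locallyIntegrableOn_univ] using this
  have hint1 : ∀ k : Fin 2, Integrable (fun y =>
      fderiv ℝ (fun y : EuclideanSpace ℝ (Fin 2) => g (‖y - x₀‖ ^ 2) * (y - x₀) k) y (EuclideanSpace.single k (1:ℝ)) * u y) := by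
    intro k
    have hV := isTestFunctionOn_radialField x₀ hg hgS k
    have hc : Continuous fun y => fderiv ℝ (fun y : EuclideanSpace ℝ (Fin 2) => g (‖y - x₀‖ ^ 2) * (y - x₀) k) y
        (EuclideanSpace.single k (1:ℝ)) :=
      (hV.contDiff.continuous_fderiv (by simp)).clm_apply continuous_const
    have hcs : HasCompactSupport fun y => fderiv ℝ (fun y : EuclideanSpace ℝ (Fin 2) => g (‖y - x₀‖ ^ 2) * (y - x₀) k) y
        (EuclideanSpace.single k (1:ℝ)) := hV.hasCompactSupport.fderiv_apply (𝕜 := ℝ) _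
    simpa [smul_eq_mul] using hul.integrable_smul_left_of_hasCompactSupport hc hcs
  have hint2 : ∀ k : Fin 2, Integrable (fun y =>
      g (‖y - x₀‖ ^ 2) * (y - x₀) k * Gu y (EuclideanSpace.single k (1:ℝ))) := by
    intro k
    have hV := isTestFunctionOn_radialField x₀ hg hgS k
    have h1 : Integrable (fun y => (g (‖y - x₀‖ ^ 2) * (y - x₀) k) • Gu y) volume :=
      hGl.integrable_smul_left_of_hasCompactSupport hV.contDiff.continuous hV.hasCompactSupport
    have h2 := (ContinuousLinearMap.apply ℝ ℝ (EuclideanSpace.single k (1:ℝ))).integrable_comp h1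
    refine h2.congr (Filter.Eventually.of_forall fun y => ?_)
    simp [smul_eq_mul]
  -- sum over `k`
  have hsum := Finset.sum_congr rfl fun (k : Fin 2) (_ : k ∈ Finset.univ) => hk k
  rw [← integral_finsetSum _ fun k _ => hint1 k, Finset.sum_neg_distrib, ← integral_finsetSum _ fun k _ => hint2 k] at hsum
  have hL : (fun y => ∑ k : Fin 2, fderiv ℝ (fun y : EuclideanSpace ℝ (Fin 2) => g (‖y - x₀‖ ^ 2) * (y - x₀) k) y
      (EuclideanSpace.single k (1:ℝ)) * u y) = fun y => 2 * (‖y - x₀‖ ^ 2 * deriv g (‖y - x₀‖ ^ 2) + g (‖y - x₀‖ ^ 2)) * u y := by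
    funext y
    rw [← Finset.sum_mul, sum_fderiv_radialField x₀ hg y]
  have hR : (fun y => ∑ k : Fin 2, g (‖y - x₀‖ ^ 2) * (y - x₀) k * Gu y (EuclideanSpace.single k (1:ℝ))) =
      fun y => g (‖y - x₀‖ ^ 2) * Gu y (y - x₀) := by
    funext y
    rw [← sum_coord_mul_apply_single (Gu y) (y - x₀), Finset.mul_sum]
    refine Finset.sum_congr rfl fun k _ => by ring
  rw [hL, hR] at hsum
  exact hsum

end Summit.QuantumFields.YangMills.Theorems.PoincareLipschitzWenteOneCentreLetters

end
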